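import Literature.MathematicalPhysics.QuantumLattice.QuasiLocalAlgebraDynamicsProofs
import Mathlib.Analysis.SpecialFunctions.ImproperIntegrals
import Mathlib.MeasureTheory.Integral.IntegralEqImproper
import Mathlib.Analysis.LocallyConvex.Separation
import Mathlib.Analysis.SpecialFunctions.Exponential
import HarnessLib

/-!
# Discharged fact: the C⋆-algebraic and the local ground-state condition agree
(`State.isGroundState_iff_toInfVolState_isGroundState`)

This file contains only theorems. It discharges the named fact
`Literature.MathematicalPhysics.QuantumLattice.State.isGroundState_iff_toInfVolState_isGroundState`
of `Literature.MathematicalPhysics.QuantumLattice.QuasiLocalAlgebra`: for the dynamics `τ` of a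
finite-range interaction `Φ` with uniformly bounded terms on the quasi-local algebra `𝔄`
(`𝔄.IsDynamicsOf τ Φ R`), a state `ω` of `𝔄` satisfies the C⋆-algebraic ground-state condition
`-i ω(a⋆ δ(a)) ≥ 0` for *every* `a` in the domain of the generator `δ` of `τ`
(`State.IsGroundState`, Bratteli–Robinson II Def. 5.3.18, Sakai Def. 4.2.1) if and only if its
family of local states satisfies it on the strictly local elements
(`InfVolState.IsGroundState`, Tasaki (2020) Def. A.14), as
`State.isGroundState_iff_toInfVolState_isGroundState_holds`. It is a sibling of
`QuasiLocalAlgebraDynamicsProofs.lean` (analyticity of local elements with Ruelle's uniform radius,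
`IsAutomorphismGroup.tendsto_taylor`, `norm_iterate_genStep_le_factorial`), which it imports.

## Proof (Bratteli–Robinson I Prop. 3.1.6, Cor. 3.1.20; Bratteli–Robinson II Thm. 6.2.4)

The implication "C⋆ ⇒ local" is immediate: `ι_Λ(A) ∈ D(δ)` with `δ(ι_Λ A) = ι_{Λ_R}(δ_Λ A)` is part
of `IsDynamicsOf`. The converse is the statement that **the local algebra is a core for the
generator `δ` of `τ`** (Bratteli–Robinson II Thm. 6.2.4: "`⋃_Λ 𝔄_Λ` is a core for `δ`"; it is an
instance of Bratteli–Robinson I Cor. 3.1.20 — a dense `δ`-invariant subspace of analytic elements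
of the generator of a group of isometries is a core), after which the ground-state inequality
passes from the core to `D(δ)` by continuity of `ω`. Mathlib has no semigroup/generator theory, so
the core property is proved here directly for the given `τ`, in three steps.
* `IsAutomorphismGroup.resolvent_sub_resolvent_eq` — the resolvent at `λ = 1` as a Laplace
  transform (Bratteli–Robinson I Prop. 3.1.6): `R a = ∫₀^∞ e^{-t} τ_t(a) dt` is a contraction and
  `R(a - δa) = a` whenever `d/dt τ_t(a)|₀ = δa` (fundamental theorem of calculus on `(0, ∞)` for
  `t ↦ e^{-t} τ_t(a)`, Mathlib `integral_Ioi_of_hasDerivAt_of_tendsto'`).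
* `QuasiLocalAlgebra.dense_ι_sub_derivation` — the range `(1 - δ)(𝔄_loc)` is dense (Sakai (1991)
  §3.4, p. 68: "`δ` is a pre-generator iff … the ranges `(λ1 + δ)D(δ)` are dense"; here for the
  restriction of the generator to `𝔄_loc`). By Hahn–Banach (Mathlib
  `geometric_hahn_banach_closed_point`) it suffices that a continuous real functional `f` vanishing
  on `(1 - δ)(𝔄_loc)` vanishes (`clm_eq_zero_of_apply_derivation_eq`): such an `f` is constant along
  the chain `x_{n+1} = δ(x_n)` of iterated derivations of a local element `b = x_0`, so by the Taylor
  expansion `τ_t(b) = Σ tⁿ/n! x_n` for `|t| K < 1` (`tendsto_taylor` with Ruelle's uniform radius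
  `1/K`, Lemma 7.6.1) `f(τ_t b) = e^t f(b)`; this extends to all of `𝔄` by density and to all
  `t = k t₀ ≥ 0` by the group law, and `|f(τ_t a)| ≤ ‖f‖‖a‖` then forces `f(a) = 0` — Sakai's proof
  of Prop. 3.4.5 (analytic elements, `f((λ - δ)a) = 0 ⇒ f(δⁿ a) = λⁿ f(a)`).
* `QuasiLocalAlgebra.exists_ι_near_of_hasDerivAt` — the core property (Bratteli–Robinson I
  Cor. 3.1.20 / proof of Cor. 3.1.7): for `a ∈ D(δ)` pick `b ∈ 𝔄_loc` with `(1-δ)b` near `(1-δ)a`;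
  then `b = R((1-δ)b)` is near `a = R((1-δ)a)` and `δb` is near `δa`.
The set `{(a, δa)}` where `-i ω(a⋆ δa) ≥ 0` is closed (`ω` is continuous, Bratteli–Robinson I
Prop. 2.3.11), which gives the discharge. The Hermiticity hypothesis of the fact is not needed.

## References

* O. Bratteli, D. W. Robinson, *Operator Algebras and Quantum Statistical Mechanics I*
  (2nd ed., Springer 1987), §3.1.2: Prop. 3.1.6 (the resolvent of the generator is the Laplace
  transform `(λI - S)⁻¹A = ∫₀^∞ e^{-λt} U_t A dt`, `‖(λI - S)⁻¹‖ ≤ (Re λ)⁻¹` for isometries),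
  Cor. 3.1.7 (proof: `R(λI - Ŝ) = X` implies `Ŝ = S`), Def. 3.1.17 (analytic elements),
  Cor. 3.1.20 (a dense invariant subspace of analytic elements is a core); Prop. 2.3.11 (states
  are continuous). [BratteliRobinsonI1987]
* O. Bratteli, D. W. Robinson, *Operator Algebras and Quantum Statistical Mechanics II*
  (2nd ed., Springer 1997), Def. 5.3.18 and Prop. 5.3.19 (ground states), Thm. 6.2.4
  (`⋃_Λ 𝔄_Λ` is a core for the generator of the dynamics of `‖Φ‖_λ < ∞` interactions), §6.2.7
  (not held locally, acq-00473; the statement used is the one vendored in `QuasiLocalAlgebra.lean`).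
  [BratteliRobinsonII1997]
* S. Sakai, *Operator Algebras in Dynamical Systems* (Cambridge University Press 1991), §3.4,
  p. 68 (pre-generators: dense ranges `(λ1 + δ)D(δ)`), Prop. 3.4.5, pp. 70–71 (dense analytic
  elements), §4.1, pp. 102–103 (finite-range interactions: `A(δ) = D(δ)`, `δ` is a pre-generator),
  Def. 4.2.1, p. 107 (ground states). [Sakai1991]
* D. Ruelle, *Statistical Mechanics: Rigorous Results* (Benjamin 1969), §7.6, Lemma 7.6.1 and
  Thm. 7.6.2, pp. 168–170 (the analyticity estimate, through the sibling file). [Ruelle1969]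
* H. Tasaki, *Physics and Mathematics of Quantum Many-Body Systems* (Springer 2020), App. A.7,
  Def. A.14 (ground states of the infinite chain by the local criterion; not held locally,
  acq-00472/acq-01008 — the statement used is the one vendored in `InfiniteVolumeStates.lean`).
  [Tasaki2020]

## Design notes

* Theorems only: the resolvent `R` enters through a defining hypothesis `hRz` (section
  `Resolvent`) and the iterated generator `G` through `hG` as in the sibling file; the discharge
  instantiates both by explicit functions.
* Everything about `𝔄` used here is in the structure fields (`ι_compatible`, `dense_range`) and in
  the sibling's chain lemmas; `‖ι_X(Φ X)‖ ≤ J` follows from `Φ.IsBounded J` because ⋆-homomorphisms of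
  C⋆-algebras are contractive (as in `exists_dynamics_holds`).
-/

noncomputable section

open Matrix Complex Finset Filter Topology MeasureTheory
open scoped Matrix.Norms.L2Operator ComplexOrder InnerProductSpace Nat

namespace Literature.MathematicalPhysics.QuantumLattice

/-! ### The resolvent of a one-parameter automorphism group as a Laplace transform -/

section CStar

variable {A : Type*} [CStarAlgebra A]

namespace IsAutomorphismGroup

variable {τ : ℝ → (A ≃⋆ₐ[ℂ] A)}

/-- The Laplace integrand `t ↦ e^{-t} τ_t(a)` of a strongly continuous group of ⋆-automorphisms is
integrable on `(0, ∞)` (it is continuous of norm `e^{-t}‖a‖`). Bratteli–Robinson I Prop. 3.1.4 /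
Prop. 3.1.6. [cite: BratteliRobinsonI1987, Prop. 3.1.6] -/
theorem integrableOn_exp_neg_smul (hτ : IsAutomorphismGroup τ) (a : A) :
    IntegrableOn (fun t : ℝ => Real.exp (-t) • τ t a) (Set.Ioi 0) := by
  refine Integrable.mono' (g := fun t => Real.exp (-t) * ‖a‖)
    (Integrable.mul_const (integrableOn_exp_neg_Ioi 0) ‖a‖) ?_ (Eventually.of_forall fun t => ?_)
  · exact ((Real.continuous_exp.comp continuous_neg).smul
      (hτ.continuous_apply a)).aestronglyMeasurable
  · rw [norm_smul, Real.norm_eq_abs, abs_of_pos (Real.exp_pos _), StarAlgEquiv.norm_map]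

section Resolvent

variable {Rz : A → A} (hRz : ∀ a : A, Rz a = ∫ t in Set.Ioi (0 : ℝ), Real.exp (-t) • τ t a)

include hRz

/-- **The resolvent is a contraction**: `‖∫₀^∞ e^{-t} τ_t(a) dt‖ ≤ ‖a‖` (the `τ_t` are isometries and
`∫₀^∞ e^{-t} dt = 1`). Bratteli–Robinson I Prop. 3.1.6 (`‖(λI - S)⁻¹‖ ≤ M (Re λ - β)⁻¹` with
`M = 1`, `β = 0`, `λ = 1`). [cite: BratteliRobinsonI1987, Prop. 3.1.6] -/
theorem norm_resolvent_le (a : A) : ‖Rz a‖ ≤ ‖a‖ := by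
  rw [hRz]
  calc ‖∫ t in Set.Ioi (0 : ℝ), Real.exp (-t) • τ t a‖
      ≤ ∫ t in Set.Ioi (0 : ℝ), Real.exp (-t) * ‖a‖ :=
        norm_integral_le_of_norm_le (Integrable.mul_const (integrableOn_exp_neg_Ioi 0) ‖a‖)
          (Eventually.of_forall fun t => by
            rw [norm_smul, Real.norm_eq_abs, abs_of_pos (Real.exp_pos _), StarAlgEquiv.norm_map])
    _ = ‖a‖ := by rw [integral_mul_const, integral_exp_neg_Ioi_zero, one_mul]

/-- The resolvent is additive: `R(a - b) = R a - R b` (linearity of the Bochner integral and of the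
`τ_t`). Bratteli–Robinson I Prop. 3.1.4. [cite: BratteliRobinsonI1987, Prop. 3.1.4] -/
theorem resolvent_sub (hτ : IsAutomorphismGroup τ) (a b : A) : Rz (a - b) = Rz a - Rz b := by
  rw [hRz, hRz, hRz, ← integral_sub (hτ.integrableOn_exp_neg_smul a) (hτ.integrableOn_exp_neg_smul b)]
  congr 1
  funext t
  rw [map_sub, smul_sub]

/-- **The Laplace transform inverts `1 - δ` on the domain of the generator**: if
`d/dt τ_t(a)|_{t=0} = δa`, then `R a - R(δa) = a`, i.e. `R((1 - δ)a) = a`. Proof: `t ↦ e^{-t} τ_t(a)`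
has derivative `e^{-t} τ_t(δa) - e^{-t} τ_t(a)`, tends to `0` at `+∞` and equals `a` at `t = 0`, so
the fundamental theorem of calculus on `(0, ∞)` gives `R(δa) - R a = 0 - a`.
Bratteli–Robinson I Prop. 3.1.6 (`R_λ(λI - S)A = A` for `A ∈ D(S)`).
[cite: BratteliRobinsonI1987, Prop. 3.1.6] -/
theorem resolvent_sub_resolvent_eq (hτ : IsAutomorphismGroup τ) {a δa : A}
    (h : HasDerivAt (fun t : ℝ => τ t a) δa 0) : Rz a - Rz δa = a := by
  have hderiv : ∀ t ∈ Set.Ici (0 : ℝ), HasDerivAt (fun t : ℝ => Real.exp (-t) • τ t a)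
      (Real.exp (-t) • τ t δa - Real.exp (-t) • τ t a) t := by
    intro t _
    have he : HasDerivAt (fun t : ℝ => Real.exp (-t)) (-Real.exp (-t)) t := by
      simpa using (_root_.hasDerivAt_neg t).exp
    have := he.smul (hτ.hasDerivAt_of_hasDerivAt_zero h t)
    rw [neg_smul, ← sub_eq_add_neg] at this
    exact this
  have hint : IntegrableOn (fun t : ℝ => Real.exp (-t) • τ t δa - Real.exp (-t) • τ t a)
      (Set.Ioi 0) :=
    Integrable.sub (hτ.integrableOn_exp_neg_smul δa) (hτ.integrableOn_exp_neg_smul a)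
  have hlim : Tendsto (fun t : ℝ => Real.exp (-t) • τ t a) atTop (𝓝 0) := by
    rw [tendsto_zero_iff_norm_tendsto_zero]
    have heq : (fun t : ℝ => ‖Real.exp (-t) • τ t a‖) = fun t => Real.exp (-t) * ‖a‖ := by
      funext t
      rw [norm_smul, Real.norm_eq_abs, abs_of_pos (Real.exp_pos _), StarAlgEquiv.norm_map]
    rw [heq]
    simpa using Real.tendsto_exp_neg_atTop_nhds_zero.mul_const ‖a‖
  have key := integral_Ioi_of_hasDerivAt_of_tendsto' hderiv hint hlim
  rw [integral_sub (hτ.integrableOn_exp_neg_smul δa) (hτ.integrableOn_exp_neg_smul a)] at key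
  simp only [neg_zero, Real.exp_zero, one_smul, hτ.map_zero_apply, zero_sub] at key
  rw [hRz, hRz, ← neg_sub, key, neg_neg]

end Resolvent

end IsAutomorphismGroup

end CStar

section QLattice

open Literature.Probability.LatticeModels
open Literature.Probability.LatticeModels (Site box mem_box)

variable {d q : ℕ}

namespace QuasiLocalAlgebra

/-! ### Density of `(1 - δ)(𝔄_loc)` -/

/-- **Linear combinations of local graph pairs are local graph pairs.** For a dynamics `τ` of `Φ`,
given local `ι_{Λ₁}(B₁)`, `ι_{Λ₂}(B₂)` and scalars `c₁, c₂`, the element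
`B = c₁ B₁ ⊗ 𝟙 + c₂ B₂ ⊗ 𝟙 ∈ 𝔄_{Λ₁ ∪ Λ₂}` has `ι(B) = c₁ ι(B₁) + c₂ ι(B₂)` and
`ι(δ B) = c₁ ι(δ B₁) + c₂ ι(δ B₂)` — the generator is linear on the local algebra (uniqueness of
derivatives, `IsDynamicsOf`). Bratteli–Robinson II Thm. 6.2.4 (the derivation `δ` on `⋃_Λ 𝔄_Λ`).
[cite: BratteliRobinsonII1997, Thm. 6.2.4] -/
theorem exists_ι_lincomb (𝔄 : QuasiLocalAlgebra d q) {τ : ℝ → (𝔄.carrier ≃⋆ₐ[ℂ] 𝔄.carrier)}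
    {Φ : LatticeInteraction d q} {R : ℝ} (hτ : 𝔄.IsDynamicsOf τ Φ R)
    (Λ₁ Λ₂ : Finset (Site d)) (B₁ : Op ↥Λ₁ q) (B₂ : Op ↥Λ₂ q) (c₁ c₂ : ℂ) :
    ∃ (Λ : Finset (Site d)) (B : Op ↥Λ q),
      𝔄.ι Λ B = c₁ • 𝔄.ι Λ₁ B₁ + c₂ • 𝔄.ι Λ₂ B₂ ∧
      𝔄.ι (thicken Λ R) (derivation Φ R Λ B) =
        c₁ • 𝔄.ι (thicken Λ₁ R) (derivation Φ R Λ₁ B₁) +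
          c₂ • 𝔄.ι (thicken Λ₂ R) (derivation Φ R Λ₂ B₂) := by
  have h1 : 𝔄.ι (Λ₁ ∪ Λ₂) (c₁ • embedOp subset_union_left B₁ + c₂ • embedOp subset_union_right B₂) =
      c₁ • 𝔄.ι Λ₁ B₁ + c₂ • 𝔄.ι Λ₂ B₂ := by
    rw [map_add, map_smul, map_smul, 𝔄.ι_compatible, 𝔄.ι_compatible]
  refine ⟨Λ₁ ∪ Λ₂, c₁ • embedOp subset_union_left B₁ + c₂ • embedOp subset_union_right B₂, h1, ?_⟩
  have hd := hτ.2 (Λ₁ ∪ Λ₂) (c₁ • embedOp subset_union_left B₁ + c₂ • embedOp subset_union_right B₂)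
  have hfun : (fun t : ℝ => τ t (𝔄.ι (Λ₁ ∪ Λ₂)
      (c₁ • embedOp subset_union_left B₁ + c₂ • embedOp subset_union_right B₂))) =
      fun t : ℝ => c₁ • τ t (𝔄.ι Λ₁ B₁) + c₂ • τ t (𝔄.ι Λ₂ B₂) := by
    funext t
    rw [h1, map_add, map_smul, map_smul]
  rw [hfun] at hd
  exact hd.unique (((hτ.2 Λ₁ B₁).fun_const_smul c₁).fun_add ((hτ.2 Λ₂ B₂).fun_const_smul c₂))

/-- **A functional annihilating `(1 - δ)(𝔄_loc)` vanishes** (the heart of Bratteli–Robinson I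
Cor. 3.1.20 for the local algebra, which consists of analytic elements for the generator with the
uniform radius `1/K` of Ruelle's Lemma 7.6.1): if a continuous real-linear functional `f` on `𝔄`
satisfies `f(δ b) = f(b)` for all strictly local `b`, then `f = 0`. Proof: `f` is constant along the
chain of iterated derivations of `b`, so `f(τ_t b) = e^t f(b)` for `|t| K < 1` by the Taylor expansion
(`IsAutomorphismGroup.tendsto_taylor`); by density and the group law `f(τ_{k t₀} a) = e^{k t₀} f(a)`
for all `a ∈ 𝔄`, `k ∈ ℕ`, which is bounded by `‖f‖‖a‖` only if `f(a) = 0`. Sakai (1991) Prop. 3.4.5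
(proof), §3.4 p. 68; Bratteli–Robinson I Cor. 3.1.20. [cite: BratteliRobinsonI1987, Cor. 3.1.20] -/
theorem clm_eq_zero_of_apply_derivation_eq (𝔄 : QuasiLocalAlgebra d q)
    {τ : ℝ → (𝔄.carrier ≃⋆ₐ[ℂ] 𝔄.carrier)} {Φ : LatticeInteraction d q} {R J : ℝ}
    (hτ : 𝔄.IsDynamicsOf τ Φ R) (hR : Φ.HasFiniteRange R)
    (hJ : ∀ X : Finset (Site d), ‖𝔄.ι X (Φ X)‖ ≤ J) (f : 𝔄.carrier →L[ℝ] ℝ)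
    (hf : ∀ (Λ : Finset (Site d)) (B : Op ↥Λ q),
      f (𝔄.ι (thicken Λ R) (derivation Φ R Λ B)) = f (𝔄.ι Λ B)) :
    f = 0 := by
  have hJ0 : 0 ≤ J := (norm_nonneg _).trans (hJ ∅)
  set K : ℝ := 2 * J * 2 ^ #(box d ⌊R⌋₊) * Real.exp #(box d ⌊R⌋₊) with hK
  have hK0 : 0 ≤ K := by positivity
  -- the iterated generator with its growing region (see `QuasiLocalAlgebraDynamicsProofs`)
  obtain ⟨G, hG⟩ : ∃ G : Finset (Site d) × 𝔄.carrier → Finset (Site d) × 𝔄.carrier,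
      ∀ (Λ' : Finset (Site d)) (y : 𝔄.carrier), G (Λ', y) =
        (thicken Λ' R, I • ∑ X ∈ (thicken Λ' R).powerset,
          (𝔄.ι X (Φ X) * y - y * 𝔄.ι X (Φ X))) :=
    ⟨fun p => (thicken p.1 R, I • ∑ X ∈ (thicken p.1 R).powerset,
      (𝔄.ι X (Φ X) * p.2 - p.2 * 𝔄.ι X (Φ X))), fun _ _ => rfl⟩
  -- Step 1: `f` is constant along the chain of iterated derivations of a local element
  have step1 : ∀ (Λ : Finset (Site d)) (A : Op ↥Λ q) (n : ℕ),
      f (G^[n] (Λ, 𝔄.ι Λ A)).2 = f (𝔄.ι Λ A) := by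
    intro Λ A n
    induction n with
    | zero => rfl
    | succ n ih =>
      obtain ⟨L, B, h⟩ := 𝔄.iterate_genStep_eq_ι Φ R hG n Λ A
      rw [h] at ih
      rw [Function.iterate_succ_apply', h, hG]
      dsimp only
      rw [← 𝔄.ι_derivation, hf L B]
      exact ih
  -- Step 2: `f (τ_t b) = e^t f(b)` for local `b` and small `t`
  have step2 : ∀ t : ℝ, |t| * K < 1 → ∀ (Λ : Finset (Site d)) (A : Op ↥Λ q),
      f (τ t (𝔄.ι Λ A)) = Real.exp t * f (𝔄.ι Λ A) := by
    intro t ht Λ A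
    set x : ℕ → 𝔄.carrier := fun n => (G^[n] (Λ, 𝔄.ι Λ A)).2 with hx
    have hb : ∀ n, ‖x n‖ ≤ ‖𝔄.ι Λ A‖ * Real.exp #Λ * n ! * K ^ n :=
      fun n => 𝔄.norm_iterate_genStep_le_factorial Φ R (G := G) hG hR hJ Λ A n
    have h1 : Tendsto (fun N => f (∑ n ∈ range (N + 1), (t ^ n / n ! : ℝ) • x n)) atTop
        (𝓝 (f (τ t (𝔄.ι Λ A)))) :=
      (f.continuous.tendsto _).comp (hτ.1.tendsto_taylor x
        (fun n => hτ.hasDerivAt_iterate_genStep 𝔄 Φ R (G := G) hG Λ A n) hK0 hb ht)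
    have hfx : ∀ n, f (x n) = f (𝔄.ι Λ A) := fun n => step1 Λ A n
    have h2 : (fun N => f (∑ n ∈ range (N + 1), (t ^ n / n ! : ℝ) • x n)) =
        fun N => (∑ n ∈ range (N + 1), t ^ n / n !) * f (𝔄.ι Λ A) := by
      funext N
      rw [map_sum, Finset.sum_mul]
      refine Finset.sum_congr rfl fun n _ => ?_
      rw [map_smul, smul_eq_mul, hfx]
    have h3 : Tendsto (fun N => (∑ n ∈ range (N + 1), t ^ n / n !) * f (𝔄.ι Λ A)) atTop
        (𝓝 (Real.exp t * f (𝔄.ι Λ A))) := by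
      have he : HasSum (fun n => t ^ n / n !) (Real.exp t) := by
        rw [Real.exp_eq_exp_ℝ]
        exact NormedSpace.expSeries_div_hasSum_exp t
      exact ((tendsto_add_atTop_iff_nat 1).2 he.tendsto_sum_nat).mul_const _
    rw [h2] at h1
    exact tendsto_nhds_unique h1 h3
  -- Step 3: all of `𝔄`, by density of the local algebra
  have step3 : ∀ t : ℝ, |t| * K < 1 → ∀ a : 𝔄.carrier, f (τ t a) = Real.exp t * f a := by
    intro t ht a
    refine 𝔄.dense_range.induction (P := fun a => f (τ t a) = Real.exp t * f a) ?_ ?_ a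
    · intro b hb
      obtain ⟨Λ, A, rfl⟩ : ∃ (Λ : Finset (Site d)) (A : Op ↥Λ q), 𝔄.ι Λ A = b := by
        simpa [Set.mem_iUnion] using hb
      exact step2 t ht Λ A
    · exact isClosed_eq (f.continuous.comp (StarAlgEquiv.isometry (τ t)).continuous)
        (continuous_const.mul f.continuous)
  -- Step 4: all positive multiples of a small time, by the group law
  obtain ⟨t₀, ht₀, ht₀K⟩ : ∃ t₀ : ℝ, 0 < t₀ ∧ |t₀| * K < 1 := by
    refine ⟨1 / (K + 1), by positivity, ?_⟩
    rw [abs_of_pos (by positivity), div_mul_eq_mul_div, one_mul, div_lt_one (by positivity)]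
    linarith
  have step4 : ∀ (k : ℕ) (a : 𝔄.carrier), f (τ (k * t₀) a) = Real.exp (k * t₀) * f a := by
    intro k
    induction k with
    | zero => intro a; simp [hτ.1.map_zero_apply]
    | succ k ih =>
      intro a
      rw [Nat.cast_add, Nat.cast_one, add_mul, one_mul, hτ.1.map_add_apply, ih, step3 t₀ ht₀K,
        Real.exp_add]
      ring
  -- Step 5: boundedness of `t ↦ f (τ_t a)` forces `f = 0`
  refine ContinuousLinearMap.ext fun a => ?_
  rw [_root_.zero_apply]
  by_contra hne
  have hpos : 0 < |f a| := abs_pos.2 hne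
  obtain ⟨k, hk⟩ := exists_nat_gt (‖f‖ * ‖a‖ / (|f a| * t₀))
  have h1 : |f (τ (k * t₀) a)| ≤ ‖f‖ * ‖a‖ := by
    rw [← Real.norm_eq_abs, ← StarAlgEquiv.norm_map (τ (k * t₀)) a]
    exact f.le_opNorm _
  rw [step4, abs_mul, abs_of_pos (Real.exp_pos _)] at h1
  have h2 : |f a| * (k * t₀) < |f a| * Real.exp (k * t₀) :=
    mul_lt_mul_of_pos_left (by linarith [Real.add_one_le_exp (k * t₀)]) hpos
  have h3 : ‖f‖ * ‖a‖ < |f a| * (k * t₀) := by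
    rw [div_lt_iff₀ (by positivity)] at hk
    linarith
  linarith

/-- **The range `(1 - δ)(𝔄_loc)` is dense in `𝔄`.** For the dynamics `τ` of a finite-range interaction
with `‖ι_X(Φ X)‖ ≤ J`, the elements `ι_Λ(B) - ι_{Λ_R}(δ_Λ B)` (`B` local) form a dense subset: it is
a subspace (`exists_ι_lincomb`), and a continuous functional vanishing on it vanishes
(`clm_eq_zero_of_apply_derivation_eq`), so Hahn–Banach applies. Sakai (1991) §3.4, p. 68 and
Prop. 3.4.5 (density of `(λ1 + δ)D(δ)` from analytic elements); Bratteli–Robinson I Thm. 3.1.18,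
Cor. 3.1.20. [cite: Sakai1991, Prop. 3.4.5, pp. 70-71] -/
theorem dense_ι_sub_derivation (𝔄 : QuasiLocalAlgebra d q)
    {τ : ℝ → (𝔄.carrier ≃⋆ₐ[ℂ] 𝔄.carrier)} {Φ : LatticeInteraction d q} {R J : ℝ}
    (hτ : 𝔄.IsDynamicsOf τ Φ R) (hR : Φ.HasFiniteRange R)
    (hJ : ∀ X : Finset (Site d), ‖𝔄.ι X (Φ X)‖ ≤ J) :
    Dense {s : 𝔄.carrier | ∃ (Λ : Finset (Site d)) (B : Op ↥Λ q),
      𝔄.ι Λ B - 𝔄.ι (thicken Λ R) (derivation Φ R Λ B) = s} := by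
  set S : Set 𝔄.carrier := {s | ∃ (Λ : Finset (Site d)) (B : Op ↥Λ q),
    𝔄.ι Λ B - 𝔄.ι (thicken Λ R) (derivation Φ R Λ B) = s} with hS
  -- `S` is a subspace
  have hlin : ∀ (c₁ c₂ : ℂ) {s₁ s₂ : 𝔄.carrier}, s₁ ∈ S → s₂ ∈ S → c₁ • s₁ + c₂ • s₂ ∈ S := by
    rintro c₁ c₂ _ _ ⟨Λ₁, B₁, rfl⟩ ⟨Λ₂, B₂, rfl⟩
    obtain ⟨Λ, B, h1, h2⟩ := 𝔄.exists_ι_lincomb hτ Λ₁ Λ₂ B₁ B₂ c₁ c₂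
    refine ⟨Λ, B, ?_⟩
    rw [h1, h2, smul_sub, smul_sub]
    abel
  have hne : (𝔄.ι ∅ 1 - 𝔄.ι (thicken ∅ R) (derivation Φ R ∅ 1)) ∈ S := ⟨∅, 1, rfl⟩
  have h0 : (0 : 𝔄.carrier) ∈ S := by simpa using hlin 0 0 hne hne
  have hconv : Convex ℝ S := fun x hx y hy a b _ _ _ => by
    simpa only [Complex.coe_smul] using hlin (a : ℂ) (b : ℂ) hx hy
  -- Hahn–Banach
  rw [dense_iff_closure_eq, Set.eq_univ_iff_forall]
  intro x
  by_contra hx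
  obtain ⟨f, u, hfS, hux⟩ :=
    geometric_hahn_banach_closed_point hconv.closure isClosed_closure hx
  have hu : 0 < u := by simpa using hfS 0 (subset_closure h0)
  have hf0 : ∀ s ∈ S, f s = 0 := by
    intro s hs
    by_contra hfs
    have hmem : ((u / f s : ℝ) : ℂ) • s + (0 : ℂ) • s ∈ S := hlin _ _ hs hs
    have := hfS _ (subset_closure hmem)
    rw [zero_smul, add_zero, Complex.coe_smul, map_smul, smul_eq_mul, div_mul_cancel₀ _ hfs] at this
    exact lt_irrefl _ this
  have hf : ∀ (Λ : Finset (Site d)) (B : Op ↥Λ q),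
      f (𝔄.ι (thicken Λ R) (derivation Φ R Λ B)) = f (𝔄.ι Λ B) := by
    intro Λ B
    have := hf0 _ ⟨Λ, B, rfl⟩
    rw [map_sub, sub_eq_zero] at this
    exact this.symm
  have hf' := 𝔄.clm_eq_zero_of_apply_derivation_eq hτ hR hJ f hf
  rw [hf', _root_.zero_apply] at hux
  linarith

/-! ### The local algebra is a core for the generator -/

/-- **The local algebra is a core for the generator of the dynamics** (Bratteli–Robinson II
Thm. 6.2.4: "`⋃_Λ 𝔄_Λ` is a core for `δ`"; Bratteli–Robinson I Cor. 3.1.20): if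
`d/dt τ_t(a)|_{t=0} = δa`, then for every `ε > 0` there is a strictly local `b = ι_Λ(B)` with
`‖b - a‖ < ε` and `‖δ(b) - δa‖ < ε`, `δ(b) = ι_{Λ_R}(δ_Λ B)`. Proof (Bratteli–Robinson I, proof of
Cor. 3.1.7): choose `(1 - δ)b` within `ε/2` of `(1 - δ)a` (`dense_ι_sub_derivation`); the resolvent
`R = (1 - δ)⁻¹ = ∫₀^∞ e^{-t} τ_t dt` is a contraction with `R((1 - δ)b) = b`, `R((1 - δ)a) = a`
(`IsAutomorphismGroup.resolvent_sub_resolvent_eq`). [cite: BratteliRobinsonII1997, Thm. 6.2.4] -/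
theorem exists_ι_near_of_hasDerivAt (𝔄 : QuasiLocalAlgebra d q)
    {τ : ℝ → (𝔄.carrier ≃⋆ₐ[ℂ] 𝔄.carrier)} {Φ : LatticeInteraction d q} {R J : ℝ}
    (hτ : 𝔄.IsDynamicsOf τ Φ R) (hR : Φ.HasFiniteRange R)
    (hJ : ∀ X : Finset (Site d), ‖𝔄.ι X (Φ X)‖ ≤ J) {a δa : 𝔄.carrier}
    (h : HasDerivAt (fun t : ℝ => τ t a) δa 0) {ε : ℝ} (hε : 0 < ε) :
    ∃ (Λ : Finset (Site d)) (B : Op ↥Λ q), ‖𝔄.ι Λ B - a‖ < ε ∧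
      ‖𝔄.ι (thicken Λ R) (derivation Φ R Λ B) - δa‖ < ε := by
  obtain ⟨s, hs, hdist⟩ :=
    Metric.mem_closure_iff.1 (𝔄.dense_ι_sub_derivation hτ hR hJ (a - δa)) (ε / 2) (half_pos hε)
  obtain ⟨Λ, B, rfl⟩ := hs
  refine ⟨Λ, B, ?_⟩
  -- the resolvent `R = ∫₀^∞ e^{-t} τ_t dt`
  obtain ⟨Rz, hRz⟩ : ∃ Rz : 𝔄.carrier → 𝔄.carrier,
      ∀ y, Rz y = ∫ t in Set.Ioi (0 : ℝ), Real.exp (-t) • τ t y := ⟨_, fun _ => rfl⟩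
  set b := 𝔄.ι Λ B with hb
  set δb := 𝔄.ι (thicken Λ R) (derivation Φ R Λ B) with hδb
  have hRb : Rz (b - δb) = b := by
    rw [IsAutomorphismGroup.resolvent_sub hRz hτ.1]
    exact IsAutomorphismGroup.resolvent_sub_resolvent_eq hRz hτ.1 (hτ.2 Λ B)
  have hRa : Rz (a - δa) = a := by
    rw [IsAutomorphismGroup.resolvent_sub hRz hτ.1]
    exact IsAutomorphismGroup.resolvent_sub_resolvent_eq hRz hτ.1 h
  have hsy : ‖(b - δb) - (a - δa)‖ < ε / 2 := by
    rwa [dist_comm, dist_eq_norm] at hdist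
  have h1 : ‖b - a‖ < ε / 2 := by
    rw [← hRb, ← hRa, ← IsAutomorphismGroup.resolvent_sub hRz hτ.1]
    exact (IsAutomorphismGroup.norm_resolvent_le hRz _).trans_lt hsy
  refine ⟨by linarith, ?_⟩
  calc ‖δb - δa‖ = ‖(b - a) - ((b - δb) - (a - δa))‖ := by congr 1; abel
    _ ≤ ‖b - a‖ + ‖(b - δb) - (a - δa)‖ := norm_sub_le _ _
    _ < ε / 2 + ε / 2 := add_lt_add h1 hsy
    _ = ε := add_halves ε

/-! ### Discharge of the fact -/

/-- **Discharge of `State.isGroundState_iff_toInfVolState_isGroundState`.** For the dynamics `τ` of a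
finite-range interaction `Φ` with uniformly bounded terms on the quasi-local algebra `𝔄`, a state `ω`
is a ground state in the C⋆-algebraic sense (`-i ω(a⋆ δ(a)) ≥ 0` on the domain of the generator,
Bratteli–Robinson II Def. 5.3.18, Sakai Def. 4.2.1) iff its family of local states satisfies the
local criterion `-i ω(A⋆ δ(A)) ≥ 0` for strictly local `A` (Tasaki (2020) Def. A.14). "⇒": local
elements lie in the domain (`IsDynamicsOf`). "⇐": the local algebra is a core for the generator
(`exists_ι_near_of_hasDerivAt`, Bratteli–Robinson II Thm. 6.2.4) and `{(a, δa) | -i ω(a⋆ δa) ≥ 0}`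
is closed since `ω` is continuous (Bratteli–Robinson I Prop. 2.3.11). The Hermiticity hypothesis
is not used. Bratteli–Robinson II Prop. 5.3.19, Thm. 6.2.4, §6.2.7; Tasaki (2020) App. A.7,
Def. A.14. [cite: Tasaki2020, App. A.7, Def. A.14] -/
theorem _root_.Literature.MathematicalPhysics.QuantumLattice.State.isGroundState_iff_toInfVolState_isGroundState_holds :
    ∀ 𝔄 : QuasiLocalAlgebra d q, State.isGroundState_iff_toInfVolState_isGroundState 𝔄 := by
  intro 𝔄 τ Φ R J hτ _hH hR hb ω
  have hJ : ∀ X : Finset (Site d), ‖𝔄.ι X (Φ X)‖ ≤ J := fun X => by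
    letI : CStarAlgebra (Op ↥X q) := { }
    exact (NonUnitalStarAlgHom.norm_apply_le (𝔄.ι X) (Φ X)).trans (hb X)
  -- the local criterion, rewritten inside `𝔄`
  have hloc_iff : ω.toInfVolState.IsGroundState Φ R ↔ ∀ (Λ : Finset (Site d)) (B : Op ↥Λ q),
      0 ≤ -I * ω (star (𝔄.ι Λ B) * 𝔄.ι (thicken Λ R) (derivation Φ R Λ B)) := by
    simp only [InfVolState.IsGroundState, State.toInfVolState_expect]
    refine forall_congr' fun Λ => forall_congr' fun B => ?_
    rw [map_mul, ← Matrix.star_eq_conjTranspose, map_star, 𝔄.ι_compatible]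
  rw [hloc_iff]
  constructor
  · intro hω Λ B
    exact hω _ _ (hτ.2 Λ B)
  · intro hloc a δa h
    have hωc : Continuous (ω : 𝔄.carrier → ℂ) := ω.toContinuousLinearMap.continuous
    have hcl : IsClosed {p : 𝔄.carrier × 𝔄.carrier | 0 ≤ -I * ω (star p.1 * p.2)} :=
      isClosed_le continuous_const (continuous_const.mul
        (hωc.comp ((continuous_star.comp continuous_fst).mul continuous_snd)))
    have hsub : {p : 𝔄.carrier × 𝔄.carrier | ∃ (Λ : Finset (Site d)) (B : Op ↥Λ q),
        (𝔄.ι Λ B, 𝔄.ι (thicken Λ R) (derivation Φ R Λ B)) = p} ⊆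
        {p | 0 ≤ -I * ω (star p.1 * p.2)} := by
      rintro _ ⟨Λ, B, rfl⟩
      exact hloc Λ B
    have hmem : (a, δa) ∈ closure {p : 𝔄.carrier × 𝔄.carrier |
        ∃ (Λ : Finset (Site d)) (B : Op ↥Λ q),
          (𝔄.ι Λ B, 𝔄.ι (thicken Λ R) (derivation Φ R Λ B)) = p} := by
      rw [Metric.mem_closure_iff]
      intro ε hε
      obtain ⟨Λ, B, h1, h2⟩ := 𝔄.exists_ι_near_of_hasDerivAt hτ hR hJ h hε
      refine ⟨_, ⟨Λ, B, rfl⟩, ?_⟩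
      rw [Prod.dist_eq, max_lt_iff]
      exact ⟨by rwa [dist_comm, dist_eq_norm], by rwa [dist_comm, dist_eq_norm]⟩
    exact hcl.closure_subset_iff.2 hsub hmem

end QuasiLocalAlgebra

end QLattice

end Literature.MathematicalPhysics.QuantumLattice
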